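import Summits.CriticalPhenomena.PercolationContinuityZ3.Theorems.PercNearOneGluingNoHeavyLowerTailKnQuestion8AntitheticDescent
import HarnessLib

/-!
# `NoHeavyLowerTail` (crux stmt-CriticalPhenomena-4575), antithetic vdBHK programme: DESCENT of the rearrangement inequality (R) along fibrations —
# (R) for a glued / product structure over `X` implies (R) for `X`; equivalently, a FAILURE of (R) at an atom persists under every wedge gluing,
# disjoint union and atom gluing (THEOREM N of FINDING-HUNT-g52: in the incidence poset of a tree, (R) fails at every vertex of degree ≥ 2).

Support file (seat `prim-ineq-gen-7` gen 52; `--supports stmt-CriticalPhenomena-4575`).  No `sorry`, no definitions.  Memo: FINDING-HUNT-g52.md §3.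

SETTING (as in `AntitheticWedgeTransfer`, `AntitheticWedgeProduct`).  `X` a finite partial order with an involution `ιX` and a subset `L`; (R) for `(X,L)` in
quadruple form.  A FIBRATION over `X`: a finite type `Y` with a relation `r` (only `r p q → π p ≤ π q` is used), a projection `π : Y → X` with all fibres
of the same positive size `k`, and an involution `ιY` with `π ∘ ιY = ιX ∘ π`.  (R) for `(Y, π⁻¹ L)` is the same formula with `r`-closed sets.
* (`AntitheticDescent.card_preimage_const_fibre`, gen 46: `#{y : π y ∈ S} = k · #S`; `AntitheticDescent.ak_of_cover` is the AK analogue of `R_descends`.)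
* `R_descends` — (R) for the fibration `(Y, r, ιY, π⁻¹L)` implies (R) for `(X, L)`: pull the eight up-sets back along `π` (constant along the fibres);
  every hypothesis lifts because `r` refines `π`-order, and all five cardinalities scale by `k`.
* `R_descends_prod` — the product `X × Z` (product order, `ιX × ιZ`, `Z` nonempty): (R) for `(X × Z, L × Z)` ⟹ (R) for `(X, L)` (converse of THEOREM R₀'s
  direction of travel; no hypothesis on `Z`).
* `R_descends_wedge` — the wedge gluing `T(X;M)` on `X × Fin 4` (relation of `AntitheticWedgePoset` for ANY subset `M`, involution `(x,i) ↦ (ιX x, s i)`):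
  (R) for `(T(X;M), L × Fin 4)` ⟹ (R) for `(X, L)`.  With `M = L` (a second wedge at the same atom) and `M = {b red}` (a wedge at another atom) this is the
  persistence of (R)-failures used in THEOREM N; the base failure is the W-fence at its middle atom (exact, FINDING-FLOW-g50 §4h).
-/

namespace Summit.CriticalPhenomena.PercolationContinuityZ3.Theorems

open Finset

namespace AntitheticWedgeDescent

variable {X Y : Type*} [PartialOrder X] [DecidableEq X] [Fintype X] [DecidableEq Y] [Fintype Y]

omit [Fintype X] in
/-- **(R) DESCENDS ALONG FIBRATIONS.**  `π : Y → X` with constant fibre size `k > 0`, a relation `r` on `Y` refining the order of `X` along `π`, involutions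
`ιX`, `ιY` with `π (ιY y) = ιX (π y)`.  If (R) holds for `(Y, π⁻¹ L)` in quadruple form (for `r`-closed sets, involution `ιY`), then (R) holds for `(X, L)`.
Contrapositive: a violation of (R) for `(X,L)` lifts (constant along fibres) to a violation for `Y`, `k` times as large. [this work] -/
theorem R_descends (r : Y → Y → Prop) (π : Y → X) (hmono : ∀ p q, r p q → π p ≤ π q)
    (ιX : X → X) (ιY : Y → Y) (hιX : Function.Involutive ιX) (hιY : Function.Involutive ιY) (hπι : ∀ y, π (ιY y) = ιX (π y))
    (k : ℕ) (hk : 0 < k) (hfib : ∀ x, (Finset.univ.filter (fun y => π y = x)).card = k)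
    (L : Finset X)
    (hRY : ∀ A₁ A₂ A₃ A₄ B₁ B₂ B₃ B₄ : Finset Y,
      (∀ p q, r p q → p ∈ A₁ → q ∈ A₁) → (∀ p q, r p q → p ∈ A₂ → q ∈ A₂) →
      (∀ p q, r p q → p ∈ A₃ → q ∈ A₃) → (∀ p q, r p q → p ∈ A₄ → q ∈ A₄) →
      (∀ p q, r p q → p ∈ B₁ → q ∈ B₁) → (∀ p q, r p q → p ∈ B₂ → q ∈ B₂) →
      (∀ p q, r p q → p ∈ B₃ → q ∈ B₃) → (∀ p q, r p q → p ∈ B₄ → q ∈ B₄) →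
      A₁ ⊆ A₃ → A₂ ⊆ A₄ → (∀ p, π p ∈ L → p ∈ A₃ → p ∈ A₄) → (∀ p, π p ∉ L → p ∈ A₁ → p ∈ A₂) →
      (∀ p q, r p q → π p ∈ L → π q ∉ L → p ∈ A₃ → q ∈ A₄) → (∀ p q, r p q → π p ∈ L → π q ∉ L → p ∈ A₂ → q ∈ A₃) →
      B₁ ⊆ B₃ → B₂ ⊆ B₄ → (∀ p, π p ∈ L → p ∈ B₃ → p ∈ B₄) → (∀ p, π p ∉ L → p ∈ B₁ → p ∈ B₂) →
      (∀ p q, r p q → π p ∈ L → π q ∉ L → p ∈ B₃ → q ∈ B₄) → (∀ p q, r p q → π p ∈ L → π q ∉ L → p ∈ B₂ → q ∈ B₃) →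
      (A₂ ∩ B₃.image ιY).card + (A₃ ∩ B₂.image ιY).card ≤
        (A₂ ∩ B₂).card + (A₃ ∩ B₃).card + ((A₄ \ A₁) ∩ (B₄ \ B₁)).card)
    (A₁ A₂ A₃ A₄ B₁ B₂ B₃ B₄ : Finset X)
    (hA₁ : ∀ x y, x ≤ y → x ∈ A₁ → y ∈ A₁) (hA₂ : ∀ x y, x ≤ y → x ∈ A₂ → y ∈ A₂)
    (hA₃ : ∀ x y, x ≤ y → x ∈ A₃ → y ∈ A₃) (hA₄ : ∀ x y, x ≤ y → x ∈ A₄ → y ∈ A₄)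
    (hB₁ : ∀ x y, x ≤ y → x ∈ B₁ → y ∈ B₁) (hB₂ : ∀ x y, x ≤ y → x ∈ B₂ → y ∈ B₂)
    (hB₃ : ∀ x y, x ≤ y → x ∈ B₃ → y ∈ B₃) (hB₄ : ∀ x y, x ≤ y → x ∈ B₄ → y ∈ B₄)
    (a13 : A₁ ⊆ A₃) (a24 : A₂ ⊆ A₄) (a34 : ∀ x, x ∈ L → x ∈ A₃ → x ∈ A₄) (a12 : ∀ x, x ∉ L → x ∈ A₁ → x ∈ A₂)
    (aC34 : ∀ x y, x ≤ y → x ∈ L → y ∉ L → x ∈ A₃ → y ∈ A₄) (aC23 : ∀ x y, x ≤ y → x ∈ L → y ∉ L → x ∈ A₂ → y ∈ A₃)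
    (b13 : B₁ ⊆ B₃) (b24 : B₂ ⊆ B₄) (b34 : ∀ x, x ∈ L → x ∈ B₃ → x ∈ B₄) (b12 : ∀ x, x ∉ L → x ∈ B₁ → x ∈ B₂)
    (bC34 : ∀ x y, x ≤ y → x ∈ L → y ∉ L → x ∈ B₃ → y ∈ B₄) (bC23 : ∀ x y, x ≤ y → x ∈ L → y ∉ L → x ∈ B₂ → y ∈ B₃) :
    (A₂ ∩ B₃.image ιX).card + (A₃ ∩ B₂.image ιX).card ≤
      (A₂ ∩ B₂).card + (A₃ ∩ B₃).card + ((A₄ \ A₁) ∩ (B₄ \ B₁)).card := by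
  classical
  -- the lifted sets
  let lift : Finset X → Finset Y := fun S => Finset.univ.filter (fun y => π y ∈ S)
  have mem_lift : ∀ (S : Finset X) (y : Y), y ∈ lift S ↔ π y ∈ S := by
    intro S y; simp only [lift, Finset.mem_filter, Finset.mem_univ, true_and]
  have up_lift : ∀ S : Finset X, (∀ x y, x ≤ y → x ∈ S → y ∈ S) → ∀ p q, r p q → p ∈ lift S → q ∈ lift S := by
    intro S hS p q hpq hp
    rw [mem_lift] at hp ⊢
    exact hS _ _ (hmono p q hpq) hp
  have sub_lift : ∀ S T : Finset X, S ⊆ T → lift S ⊆ lift T := by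
    intro S T hST p hp
    rw [mem_lift] at hp ⊢
    exact hST hp
  have subL_lift : ∀ S T : Finset X, (∀ x, x ∈ L → x ∈ S → x ∈ T) → ∀ p, π p ∈ L → p ∈ lift S → p ∈ lift T := by
    intro S T hST p hpL hp
    rw [mem_lift] at hp ⊢
    exact hST _ hpL hp
  have subP_lift : ∀ S T : Finset X, (∀ x, x ∉ L → x ∈ S → x ∈ T) → ∀ p, π p ∉ L → p ∈ lift S → p ∈ lift T := by
    intro S T hST p hpL hp
    rw [mem_lift] at hp ⊢
    exact hST _ hpL hp
  have cross_lift : ∀ S T : Finset X, (∀ x y, x ≤ y → x ∈ L → y ∉ L → x ∈ S → y ∈ T) →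
      ∀ p q, r p q → π p ∈ L → π q ∉ L → p ∈ lift S → q ∈ lift T := by
    intro S T hST p q hpq hpL hqL hp
    rw [mem_lift] at hp ⊢
    exact hST _ _ (hmono p q hpq) hpL hqL hp
  have key := hRY (lift A₁) (lift A₂) (lift A₃) (lift A₄) (lift B₁) (lift B₂) (lift B₃) (lift B₄)
    (up_lift A₁ hA₁) (up_lift A₂ hA₂) (up_lift A₃ hA₃) (up_lift A₄ hA₄) (up_lift B₁ hB₁) (up_lift B₂ hB₂) (up_lift B₃ hB₃) (up_lift B₄ hB₄)
    (sub_lift A₁ A₃ a13) (sub_lift A₂ A₄ a24) (subL_lift A₃ A₄ a34) (subP_lift A₁ A₂ a12) (cross_lift A₃ A₄ aC34) (cross_lift A₂ A₃ aC23)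
    (sub_lift B₁ B₃ b13) (sub_lift B₂ B₄ b24) (subL_lift B₃ B₄ b34) (subP_lift B₁ B₂ b12) (cross_lift B₃ B₄ bC34) (cross_lift B₂ B₃ bC23)
  -- the five cardinalities scale by k
  have e_inter : ∀ S T : Finset X, lift S ∩ lift T = lift (S ∩ T) := by
    intro S T; ext y
    rw [Finset.mem_inter, mem_lift, mem_lift, mem_lift, Finset.mem_inter]
  have e_sdiff : ∀ S T : Finset X, lift S \ lift T = lift (S \ T) := by
    intro S T; ext y
    rw [Finset.mem_sdiff, mem_lift, mem_lift, mem_lift, Finset.mem_sdiff]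
  have e_image : ∀ S : Finset X, (lift S).image ιY = lift (S.image ιX) := by
    intro S; ext y
    rw [Finset.mem_image, mem_lift, Finset.mem_image]
    constructor
    · rintro ⟨y', hy', hyy⟩
      rw [mem_lift] at hy'
      exact ⟨π y', hy', by rw [← hyy, hπι]⟩
    · rintro ⟨x, hx, hxy⟩
      refine ⟨ιY y, ?_, hιY y⟩
      rw [mem_lift, hπι, ← hxy, hιX x]
      exact hx
  have c1 : (lift A₂ ∩ (lift B₃).image ιY).card = k * (A₂ ∩ B₃.image ιX).card := by
    rw [e_image, e_inter]; exact AntitheticDescent.card_preimage_const_fibre π k hfib _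
  have c2 : (lift A₃ ∩ (lift B₂).image ιY).card = k * (A₃ ∩ B₂.image ιX).card := by
    rw [e_image, e_inter]; exact AntitheticDescent.card_preimage_const_fibre π k hfib _
  have c3 : (lift A₂ ∩ lift B₂).card = k * (A₂ ∩ B₂).card := by
    rw [e_inter]; exact AntitheticDescent.card_preimage_const_fibre π k hfib _
  have c4 : (lift A₃ ∩ lift B₃).card = k * (A₃ ∩ B₃).card := by
    rw [e_inter]; exact AntitheticDescent.card_preimage_const_fibre π k hfib _
  have c5 : ((lift A₄ \ lift A₁) ∩ (lift B₄ \ lift B₁)).card = k * ((A₄ \ A₁) ∩ (B₄ \ B₁)).card := by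
    rw [e_sdiff, e_sdiff, e_inter]; exact AntitheticDescent.card_preimage_const_fibre π k hfib _
  have key' : k * ((A₂ ∩ B₃.image ιX).card + (A₃ ∩ B₂.image ιX).card) ≤
      k * ((A₂ ∩ B₂).card + (A₃ ∩ B₃).card + ((A₄ \ A₁) ∩ (B₄ \ B₁)).card) := by
    have := key
    rw [c1, c2, c3, c4, c5] at this
    simpa [mul_add] using this
  exact Nat.le_of_mul_le_mul_left key' hk

/-- The common shape of the (R) hypothesis/conclusion in quadruple form for `(X, ≤, ι, L)` — spelled out, as in `AntitheticWedgeTransfer.wedge_transfer`.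
**Product descent.**  For a nonempty finite partial order `Z` with any self-map `ιZ`: (R) for `(X × Z, product order, ιX × ιZ, L × Z)` implies (R) for
`(X, L)`.  (THEOREM R₀, `AntitheticWedgeProduct.product_R`, goes the other way under AK(Z).)  Hence a violation of (R) at an atom of `Ω_Q` persists in
`Ω_{Q ⊔ Q'} = Ω_Q × Ω_{Q'}`. [this work] -/
theorem R_descends_prod {Z : Type*} [PartialOrder Z] [DecidableEq Z] [Fintype Z] [Nonempty Z]
    (ιX : X → X) (ιZ : Z → Z) (hιX : Function.Involutive ιX) (hιZ : Function.Involutive ιZ) (L : Finset X)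
    (hRY : ∀ A₁ A₂ A₃ A₄ B₁ B₂ B₃ B₄ : Finset (X × Z),
      (∀ p q, p ≤ q → p ∈ A₁ → q ∈ A₁) → (∀ p q, p ≤ q → p ∈ A₂ → q ∈ A₂) →
      (∀ p q, p ≤ q → p ∈ A₃ → q ∈ A₃) → (∀ p q, p ≤ q → p ∈ A₄ → q ∈ A₄) →
      (∀ p q, p ≤ q → p ∈ B₁ → q ∈ B₁) → (∀ p q, p ≤ q → p ∈ B₂ → q ∈ B₂) →
      (∀ p q, p ≤ q → p ∈ B₃ → q ∈ B₃) → (∀ p q, p ≤ q → p ∈ B₄ → q ∈ B₄) →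
      A₁ ⊆ A₃ → A₂ ⊆ A₄ → (∀ p, p.1 ∈ L → p ∈ A₃ → p ∈ A₄) → (∀ p, p.1 ∉ L → p ∈ A₁ → p ∈ A₂) →
      (∀ p q, p ≤ q → p.1 ∈ L → q.1 ∉ L → p ∈ A₃ → q ∈ A₄) → (∀ p q, p ≤ q → p.1 ∈ L → q.1 ∉ L → p ∈ A₂ → q ∈ A₃) →
      B₁ ⊆ B₃ → B₂ ⊆ B₄ → (∀ p, p.1 ∈ L → p ∈ B₃ → p ∈ B₄) → (∀ p, p.1 ∉ L → p ∈ B₁ → p ∈ B₂) →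
      (∀ p q, p ≤ q → p.1 ∈ L → q.1 ∉ L → p ∈ B₃ → q ∈ B₄) → (∀ p q, p ≤ q → p.1 ∈ L → q.1 ∉ L → p ∈ B₂ → q ∈ B₃) →
      (A₂ ∩ B₃.image (fun p => (ιX p.1, ιZ p.2))).card + (A₃ ∩ B₂.image (fun p => (ιX p.1, ιZ p.2))).card ≤
        (A₂ ∩ B₂).card + (A₃ ∩ B₃).card + ((A₄ \ A₁) ∩ (B₄ \ B₁)).card)
    (A₁ A₂ A₃ A₄ B₁ B₂ B₃ B₄ : Finset X)
    (hA₁ : ∀ x y, x ≤ y → x ∈ A₁ → y ∈ A₁) (hA₂ : ∀ x y, x ≤ y → x ∈ A₂ → y ∈ A₂)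
    (hA₃ : ∀ x y, x ≤ y → x ∈ A₃ → y ∈ A₃) (hA₄ : ∀ x y, x ≤ y → x ∈ A₄ → y ∈ A₄)
    (hB₁ : ∀ x y, x ≤ y → x ∈ B₁ → y ∈ B₁) (hB₂ : ∀ x y, x ≤ y → x ∈ B₂ → y ∈ B₂)
    (hB₃ : ∀ x y, x ≤ y → x ∈ B₃ → y ∈ B₃) (hB₄ : ∀ x y, x ≤ y → x ∈ B₄ → y ∈ B₄)
    (a13 : A₁ ⊆ A₃) (a24 : A₂ ⊆ A₄) (a34 : ∀ x, x ∈ L → x ∈ A₃ → x ∈ A₄) (a12 : ∀ x, x ∉ L → x ∈ A₁ → x ∈ A₂)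
    (aC34 : ∀ x y, x ≤ y → x ∈ L → y ∉ L → x ∈ A₃ → y ∈ A₄) (aC23 : ∀ x y, x ≤ y → x ∈ L → y ∉ L → x ∈ A₂ → y ∈ A₃)
    (b13 : B₁ ⊆ B₃) (b24 : B₂ ⊆ B₄) (b34 : ∀ x, x ∈ L → x ∈ B₃ → x ∈ B₄) (b12 : ∀ x, x ∉ L → x ∈ B₁ → x ∈ B₂)
    (bC34 : ∀ x y, x ≤ y → x ∈ L → y ∉ L → x ∈ B₃ → y ∈ B₄) (bC23 : ∀ x y, x ≤ y → x ∈ L → y ∉ L → x ∈ B₂ → y ∈ B₃) :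
    (A₂ ∩ B₃.image ιX).card + (A₃ ∩ B₂.image ιX).card ≤
      (A₂ ∩ B₂).card + (A₃ ∩ B₃).card + ((A₄ \ A₁) ∩ (B₄ \ B₁)).card := by
  classical
  have hfib : ∀ x : X, (Finset.univ.filter (fun y : X × Z => y.1 = x)).card = Fintype.card Z := by
    intro x
    have : (Finset.univ.filter (fun y : X × Z => y.1 = x)) = (({x} : Finset X) ×ˢ (Finset.univ : Finset Z)) := by
      ext ⟨a, b⟩
      simp only [Finset.mem_filter, Finset.mem_univ, true_and, Finset.mem_product, Finset.mem_singleton, and_true]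
    rw [this, Finset.card_product, Finset.card_singleton, one_mul, Finset.card_univ]
  exact R_descends (fun p q : X × Z => p ≤ q) Prod.fst (fun p q h => h.1) ιX (fun p => (ιX p.1, ιZ p.2)) hιX
    (fun p => by simp [hιX p.1, hιZ p.2]) (fun _ => rfl) (Fintype.card Z) Fintype.card_pos hfib L
    hRY A₁ A₂ A₃ A₄ B₁ B₂ B₃ B₄ hA₁ hA₂ hA₃ hA₄ hB₁ hB₂ hB₃ hB₄ a13 a24 a34 a12 aC34 aC23 b13 b24 b34 b12 bC34 bC23

/-- **Wedge descent (persistence of (R)-failures under wedge gluing).**  `T(X;M)` = `X × Fin 4` with the wedge-gluing relation of `AntitheticWedgePoset` for an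
ARBITRARY subset `M` (the half of the atom at which the wedge is glued; `M = L` is allowed), involution `(x,i) ↦ (ιX x, s i)` for any involutive sheet map `s`.
If (R) holds for `(T(X;M), L × Fin 4)` (quadruple form over sets up-closed for the relation), then (R) holds for `(X, L)`.  Contrapositive: the failure of (R) at an
atom `a` of `Ω_Q` persists in `Ω_{Q ∪_b wedge}` for every atom `b` (including `b = a`); with the exact failure at the middle atom of the W-fence this gives
THEOREM N (trees: (R) fails at every vertex of degree ≥ 2). [this work] -/
theorem R_descends_wedge (ιX : X → X) (hιX : Function.Involutive ιX) (s : Fin 4 → Fin 4) (hss : ∀ i, s (s i) = i) (M L : Finset X)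
    (hRY : ∀ A₁ A₂ A₃ A₄ B₁ B₂ B₃ B₄ : Finset (X × Fin 4),
      (∀ p q, (p.1 ≤ q.1 ∧ (p.2 = q.2 ∨ (p.2 = 0 ∧ q.2 = 2) ∨ (p.2 = 1 ∧ q.2 = 3) ∨ (p.2 = 0 ∧ q.2 = 3) ∨ (p.2 = 2 ∧ q.2 = 3 ∧ p.1 ∈ M) ∨
        (p.2 = 0 ∧ q.2 = 1 ∧ q.1 ∉ M) ∨ (p.2 = 1 ∧ q.2 = 2 ∧ p.1 ∈ M ∧ q.1 ∉ M))) → p ∈ A₁ → q ∈ A₁) →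
      (∀ p q, (p.1 ≤ q.1 ∧ (p.2 = q.2 ∨ (p.2 = 0 ∧ q.2 = 2) ∨ (p.2 = 1 ∧ q.2 = 3) ∨ (p.2 = 0 ∧ q.2 = 3) ∨ (p.2 = 2 ∧ q.2 = 3 ∧ p.1 ∈ M) ∨
        (p.2 = 0 ∧ q.2 = 1 ∧ q.1 ∉ M) ∨ (p.2 = 1 ∧ q.2 = 2 ∧ p.1 ∈ M ∧ q.1 ∉ M))) → p ∈ A₂ → q ∈ A₂) →
      (∀ p q, (p.1 ≤ q.1 ∧ (p.2 = q.2 ∨ (p.2 = 0 ∧ q.2 = 2) ∨ (p.2 = 1 ∧ q.2 = 3) ∨ (p.2 = 0 ∧ q.2 = 3) ∨ (p.2 = 2 ∧ q.2 = 3 ∧ p.1 ∈ M) ∨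
        (p.2 = 0 ∧ q.2 = 1 ∧ q.1 ∉ M) ∨ (p.2 = 1 ∧ q.2 = 2 ∧ p.1 ∈ M ∧ q.1 ∉ M))) → p ∈ A₃ → q ∈ A₃) →
      (∀ p q, (p.1 ≤ q.1 ∧ (p.2 = q.2 ∨ (p.2 = 0 ∧ q.2 = 2) ∨ (p.2 = 1 ∧ q.2 = 3) ∨ (p.2 = 0 ∧ q.2 = 3) ∨ (p.2 = 2 ∧ q.2 = 3 ∧ p.1 ∈ M) ∨
        (p.2 = 0 ∧ q.2 = 1 ∧ q.1 ∉ M) ∨ (p.2 = 1 ∧ q.2 = 2 ∧ p.1 ∈ M ∧ q.1 ∉ M))) → p ∈ A₄ → q ∈ A₄) →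
      (∀ p q, (p.1 ≤ q.1 ∧ (p.2 = q.2 ∨ (p.2 = 0 ∧ q.2 = 2) ∨ (p.2 = 1 ∧ q.2 = 3) ∨ (p.2 = 0 ∧ q.2 = 3) ∨ (p.2 = 2 ∧ q.2 = 3 ∧ p.1 ∈ M) ∨
        (p.2 = 0 ∧ q.2 = 1 ∧ q.1 ∉ M) ∨ (p.2 = 1 ∧ q.2 = 2 ∧ p.1 ∈ M ∧ q.1 ∉ M))) → p ∈ B₁ → q ∈ B₁) →
      (∀ p q, (p.1 ≤ q.1 ∧ (p.2 = q.2 ∨ (p.2 = 0 ∧ q.2 = 2) ∨ (p.2 = 1 ∧ q.2 = 3) ∨ (p.2 = 0 ∧ q.2 = 3) ∨ (p.2 = 2 ∧ q.2 = 3 ∧ p.1 ∈ M) ∨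
        (p.2 = 0 ∧ q.2 = 1 ∧ q.1 ∉ M) ∨ (p.2 = 1 ∧ q.2 = 2 ∧ p.1 ∈ M ∧ q.1 ∉ M))) → p ∈ B₂ → q ∈ B₂) →
      (∀ p q, (p.1 ≤ q.1 ∧ (p.2 = q.2 ∨ (p.2 = 0 ∧ q.2 = 2) ∨ (p.2 = 1 ∧ q.2 = 3) ∨ (p.2 = 0 ∧ q.2 = 3) ∨ (p.2 = 2 ∧ q.2 = 3 ∧ p.1 ∈ M) ∨
        (p.2 = 0 ∧ q.2 = 1 ∧ q.1 ∉ M) ∨ (p.2 = 1 ∧ q.2 = 2 ∧ p.1 ∈ M ∧ q.1 ∉ M))) → p ∈ B₃ → q ∈ B₃) →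
      (∀ p q, (p.1 ≤ q.1 ∧ (p.2 = q.2 ∨ (p.2 = 0 ∧ q.2 = 2) ∨ (p.2 = 1 ∧ q.2 = 3) ∨ (p.2 = 0 ∧ q.2 = 3) ∨ (p.2 = 2 ∧ q.2 = 3 ∧ p.1 ∈ M) ∨
        (p.2 = 0 ∧ q.2 = 1 ∧ q.1 ∉ M) ∨ (p.2 = 1 ∧ q.2 = 2 ∧ p.1 ∈ M ∧ q.1 ∉ M))) → p ∈ B₄ → q ∈ B₄) →
      A₁ ⊆ A₃ → A₂ ⊆ A₄ → (∀ p, p.1 ∈ L → p ∈ A₃ → p ∈ A₄) → (∀ p, p.1 ∉ L → p ∈ A₁ → p ∈ A₂) →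
      (∀ p q, (p.1 ≤ q.1 ∧ (p.2 = q.2 ∨ (p.2 = 0 ∧ q.2 = 2) ∨ (p.2 = 1 ∧ q.2 = 3) ∨ (p.2 = 0 ∧ q.2 = 3) ∨ (p.2 = 2 ∧ q.2 = 3 ∧ p.1 ∈ M) ∨
        (p.2 = 0 ∧ q.2 = 1 ∧ q.1 ∉ M) ∨ (p.2 = 1 ∧ q.2 = 2 ∧ p.1 ∈ M ∧ q.1 ∉ M))) → p.1 ∈ L → q.1 ∉ L → p ∈ A₃ → q ∈ A₄) →
      (∀ p q, (p.1 ≤ q.1 ∧ (p.2 = q.2 ∨ (p.2 = 0 ∧ q.2 = 2) ∨ (p.2 = 1 ∧ q.2 = 3) ∨ (p.2 = 0 ∧ q.2 = 3) ∨ (p.2 = 2 ∧ q.2 = 3 ∧ p.1 ∈ M) ∨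
        (p.2 = 0 ∧ q.2 = 1 ∧ q.1 ∉ M) ∨ (p.2 = 1 ∧ q.2 = 2 ∧ p.1 ∈ M ∧ q.1 ∉ M))) → p.1 ∈ L → q.1 ∉ L → p ∈ A₂ → q ∈ A₃) →
      B₁ ⊆ B₃ → B₂ ⊆ B₄ → (∀ p, p.1 ∈ L → p ∈ B₃ → p ∈ B₄) → (∀ p, p.1 ∉ L → p ∈ B₁ → p ∈ B₂) →
      (∀ p q, (p.1 ≤ q.1 ∧ (p.2 = q.2 ∨ (p.2 = 0 ∧ q.2 = 2) ∨ (p.2 = 1 ∧ q.2 = 3) ∨ (p.2 = 0 ∧ q.2 = 3) ∨ (p.2 = 2 ∧ q.2 = 3 ∧ p.1 ∈ M) ∨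
        (p.2 = 0 ∧ q.2 = 1 ∧ q.1 ∉ M) ∨ (p.2 = 1 ∧ q.2 = 2 ∧ p.1 ∈ M ∧ q.1 ∉ M))) → p.1 ∈ L → q.1 ∉ L → p ∈ B₃ → q ∈ B₄) →
      (∀ p q, (p.1 ≤ q.1 ∧ (p.2 = q.2 ∨ (p.2 = 0 ∧ q.2 = 2) ∨ (p.2 = 1 ∧ q.2 = 3) ∨ (p.2 = 0 ∧ q.2 = 3) ∨ (p.2 = 2 ∧ q.2 = 3 ∧ p.1 ∈ M) ∨
        (p.2 = 0 ∧ q.2 = 1 ∧ q.1 ∉ M) ∨ (p.2 = 1 ∧ q.2 = 2 ∧ p.1 ∈ M ∧ q.1 ∉ M))) → p.1 ∈ L → q.1 ∉ L → p ∈ B₂ → q ∈ B₃) →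
      (A₂ ∩ B₃.image (fun p => (ιX p.1, s p.2))).card + (A₃ ∩ B₂.image (fun p => (ιX p.1, s p.2))).card ≤
        (A₂ ∩ B₂).card + (A₃ ∩ B₃).card + ((A₄ \ A₁) ∩ (B₄ \ B₁)).card)
    (A₁ A₂ A₃ A₄ B₁ B₂ B₃ B₄ : Finset X)
    (hA₁ : ∀ x y, x ≤ y → x ∈ A₁ → y ∈ A₁) (hA₂ : ∀ x y, x ≤ y → x ∈ A₂ → y ∈ A₂)
    (hA₃ : ∀ x y, x ≤ y → x ∈ A₃ → y ∈ A₃) (hA₄ : ∀ x y, x ≤ y → x ∈ A₄ → y ∈ A₄)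
    (hB₁ : ∀ x y, x ≤ y → x ∈ B₁ → y ∈ B₁) (hB₂ : ∀ x y, x ≤ y → x ∈ B₂ → y ∈ B₂)
    (hB₃ : ∀ x y, x ≤ y → x ∈ B₃ → y ∈ B₃) (hB₄ : ∀ x y, x ≤ y → x ∈ B₄ → y ∈ B₄)
    (a13 : A₁ ⊆ A₃) (a24 : A₂ ⊆ A₄) (a34 : ∀ x, x ∈ L → x ∈ A₃ → x ∈ A₄) (a12 : ∀ x, x ∉ L → x ∈ A₁ → x ∈ A₂)
    (aC34 : ∀ x y, x ≤ y → x ∈ L → y ∉ L → x ∈ A₃ → y ∈ A₄) (aC23 : ∀ x y, x ≤ y → x ∈ L → y ∉ L → x ∈ A₂ → y ∈ A₃)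
    (b13 : B₁ ⊆ B₃) (b24 : B₂ ⊆ B₄) (b34 : ∀ x, x ∈ L → x ∈ B₃ → x ∈ B₄) (b12 : ∀ x, x ∉ L → x ∈ B₁ → x ∈ B₂)
    (bC34 : ∀ x y, x ≤ y → x ∈ L → y ∉ L → x ∈ B₃ → y ∈ B₄) (bC23 : ∀ x y, x ≤ y → x ∈ L → y ∉ L → x ∈ B₂ → y ∈ B₃) :
    (A₂ ∩ B₃.image ιX).card + (A₃ ∩ B₂.image ιX).card ≤
      (A₂ ∩ B₂).card + (A₃ ∩ B₃).card + ((A₄ \ A₁) ∩ (B₄ \ B₁)).card := by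
  classical
  have hfib : ∀ x : X, (Finset.univ.filter (fun y : X × Fin 4 => y.1 = x)).card = 4 := by
    intro x
    have : (Finset.univ.filter (fun y : X × Fin 4 => y.1 = x)) = (({x} : Finset X) ×ˢ (Finset.univ : Finset (Fin 4))) := by
      ext ⟨a, b⟩
      simp only [Finset.mem_filter, Finset.mem_univ, true_and, Finset.mem_product, Finset.mem_singleton, and_true]
    rw [this, Finset.card_product, Finset.card_singleton, one_mul, Finset.card_univ, Fintype.card_fin]
  exact R_descends
    (fun p q : X × Fin 4 => (p.1 ≤ q.1 ∧ (p.2 = q.2 ∨ (p.2 = 0 ∧ q.2 = 2) ∨ (p.2 = 1 ∧ q.2 = 3) ∨ (p.2 = 0 ∧ q.2 = 3) ∨ (p.2 = 2 ∧ q.2 = 3 ∧ p.1 ∈ M) ∨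
        (p.2 = 0 ∧ q.2 = 1 ∧ q.1 ∉ M) ∨ (p.2 = 1 ∧ q.2 = 2 ∧ p.1 ∈ M ∧ q.1 ∉ M))))
    Prod.fst (fun p q h => h.1) ιX (fun p => (ιX p.1, s p.2)) hιX (fun p => by simp [hιX p.1, hss p.2]) (fun _ => rfl) 4 (by norm_num) hfib L
    hRY A₁ A₂ A₃ A₄ B₁ B₂ B₃ B₄ hA₁ hA₂ hA₃ hA₄ hB₁ hB₂ hB₃ hB₄ a13 a24 a34 a12 aC34 aC23 b13 b24 b34 b12 bC34 bC23

end AntitheticWedgeDescent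

end Summit.CriticalPhenomena.PercolationContinuityZ3.Theorems
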